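import Mathlib
import Summits.ValiantsHypothesis.ValiantsHypothesis.Theorems.NewtonUnitEquationsDissociatedUniformTotalsLaw
import Summits.ValiantsHypothesis.ValiantsHypothesis.Theorems.NewtonUnitEquationsDissociatedUniformTotalsLawRankOne
import Literature.Computability.AlgebraicComplexity.NewtonPolygonTauProductBounds
import HarnessLib

/-!
# Crux `NewtonUnitEquations.DissociatedUniform` (stmt-ValiantsHypothesis-5905), `n = 3` totals law of model (Q**):
# the envelope bound needs `C ≥ 3` — a certified `ℤ/4` configuration with `9 = 2·4 + 1` pieces

Companion of `…TotalsLawRankOne` (`envPieces φ ψ c` = number of south-west exposed points of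
`{(ψ y + c (x+y), φ x + c (x+y))}`, i.e. pieces of the lower envelope on `[0,1]` of the lines `τ φ x + (1-τ) ψ y + c (x+y)`;
located `@[conjecture] EnvelopeBound C : envPieces ≤ C·|G|`).  THIS FILE certifies in the kernel the census witness of memo
`Cruxes/DissociatedUniform/NOTES-t1g19.md` §3 at `|G| = 4` (found by annealing, HOME g19/exp/L4c.log):
`φ = (590575101002, 51896053, 8690650, 4311062)`, `ψ = (68369320, 7087214, 2466849, 1561401354)`,
`c = (9609997, 10206119, 1235406, 5546003)` on `ℤ/4` has the NINE pieces
`(0,2), (1,2), (1,1), (2,2), (2,1), (3,1), (2,0), (3,0), (3,3)` (strict minimisers at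
`τ = 0, 1/15, 1/11, 1/9, 1/2, 13/14, 14/15, 63/64, 1`; exact integer arithmetic by `decide` after clearing denominators), so `envPieces ≥ 9 > 2·4`:
* `nine_le_envPieces`, **`not_envelopeBound_two : ¬ EnvelopeBound 2`**, `envelopeBound_three_le : EnvelopeBound C → 3 ≤ C`.
Also the generic evaluation lemmas `ecost`, `dot_envPt`, `isSWExposed_of_ecost` (a cell strictly minimising the `τ`-cost over all
cells is south-west exposed).  Honest label: a located constant pinned from below; `EnvelopeBound 3`, `RankOnePointwise`,
`TotalsLawThree` remain OPEN; VP ≠ VNP is not touched.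
[folklore: exact integer arithmetic]
-/

set_option linter.dupNamespace false -- `ValiantsHypothesis.ValiantsHypothesis` (summit = problem) in every name

open Matrix Finset

namespace Summit.ValiantsHypothesis.ValiantsHypothesis.Theorems.NewtonUnitEquationsDissociatedUniform

namespace TotalsLaw

open Literature.Computability.AlgebraicComplexity.KPTT.PlanarMinkowski

section Generic

variable {G : Type*} [AddCommGroup G]

/-- The `τ`-cost of a cell: `(1-τ)(ψ y + c (x+y)) + τ (φ x + c (x+y))`. -/
def ecost (φ ψ c : G → ℝ) (τ : ℝ) (q : G × G) : ℝ :=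
  (1 - τ) * (ψ q.2 + c (q.1 + q.2)) + τ * (φ q.1 + c (q.1 + q.2))

/-- The south-west weight pairs with an (ENV) point to minus the `τ`-cost. [folklore] -/
theorem dot_envPt (φ ψ c : G → ℝ) (τ : ℝ) (q : G × G) :
    ![-(1 - τ), -τ] ⬝ᵥ envPt φ ψ c q = -ecost φ ψ c τ q := by
  rw [vec2_dot]
  simp only [envPt, ecost, cons_val_zero, cons_val_one]
  ring

variable [Fintype G]

/-- A cell strictly minimising the `τ`-cost over all cells (`τ ∈ [0,1]`) is south-west exposed. [folklore] -/
theorem isSWExposed_of_ecost (φ ψ c : G → ℝ) (cl : G × G) {τ : ℝ} (h0 : 0 ≤ τ) (h1 : τ ≤ 1)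
    (h : ∀ q : G × G, q = cl ∨ ecost φ ψ c τ cl < ecost φ ψ c τ q) :
    IsSWExposed (envPts φ ψ c) (envPt φ ψ c cl) := by
  classical
  refine ⟨τ, h0, h1, ?_, fun y hy hne => ?_⟩
  · unfold envPts
    exact Finset.mem_image.2 ⟨cl, Finset.mem_univ _, rfl⟩
  · unfold envPts at hy
    obtain ⟨q, -, rfl⟩ := Finset.mem_image.1 hy
    rcases h q with hq | hq
    · exact absurd (by rw [hq]) hne
    · rw [dot_envPt, dot_envPt]
      linarith

end Generic

/-! ### The `ℤ/4` witness (integer data, cast to `ℝ`) -/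

namespace EnvCex4

/-- Row values (integers). -/
def phiZ (x : ZMod 4) : ℤ :=
  if x.val = 0 then 590575101002 else if x.val = 1 then 51896053 else if x.val = 2 then 8690650 else 4311062
/-- Column values (integers). -/
def psiZ (x : ZMod 4) : ℤ :=
  if x.val = 0 then 68369320 else if x.val = 1 then 7087214 else if x.val = 2 then 2466849 else 1561401354
/-- Lift values (integers). -/
def cZ (x : ZMod 4) : ℤ :=
  if x.val = 0 then 9609997 else if x.val = 1 then 10206119 else if x.val = 2 then 1235406 else 5546003

/-- `φ` of the witness. -/
def φ₄ (x : ZMod 4) : ℝ := (phiZ x : ℝ)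
/-- `ψ` of the witness. -/
def ψ₄ (y : ZMod 4) : ℝ := (psiZ y : ℝ)
/-- `c` of the witness. -/
def c₄ (r : ZMod 4) : ℝ := (cZ r : ℝ)

/-- Integer `τ`-cost with denominators cleared: `(den - num)·X + num·Y` for `τ = num/den`. -/
def ecostZ (num den : ℤ) (q : ZMod 4 × ZMod 4) : ℤ :=
  (den - num) * (psiZ q.2 + cZ (q.1 + q.2)) + num * (phiZ q.1 + cZ (q.1 + q.2))

/-- The real cost at `τ = num/den` is the integer cost divided by `den`. [folklore] -/
theorem ecost_eq_div (num den : ℤ) (hden : (0 : ℝ) < den) (q : ZMod 4 × ZMod 4) :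
    ecost φ₄ ψ₄ c₄ ((num : ℝ) / den) q = (ecostZ num den q : ℝ) / den := by
  simp only [ecost, ecostZ, φ₄, ψ₄, c₄]
  push_cast
  field_simp

/-- Transfer of an integer strict-minimiser certificate to `ℝ`. [folklore] -/
theorem isSWExposed_of_ecostZ (num den : ℤ) (h0 : (0 : ℝ) ≤ num) (h1 : (num : ℝ) ≤ den) (hden : (0 : ℝ) < den)
    (cl : ZMod 4 × ZMod 4) (h : ∀ q : ZMod 4 × ZMod 4, q = cl ∨ ecostZ num den cl < ecostZ num den q) :
    IsSWExposed (envPts φ₄ ψ₄ c₄) (envPt φ₄ ψ₄ c₄ cl) := by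
  refine isSWExposed_of_ecost φ₄ ψ₄ c₄ cl (τ := (num : ℝ) / den) (div_nonneg h0 hden.le)
    ((div_le_one hden).2 h1) fun q => ?_
  rcases h q with hq | hq
  · exact Or.inl hq
  · right
    rw [ecost_eq_div num den hden, ecost_eq_div num den hden]
    exact div_lt_div_of_pos_right (by exact_mod_cast hq) hden

/-- Cell `(0, 2)` is the strict minimiser at `τ = 0/1` (exact integer check, denominators cleared). -/
theorem pieceZ_02 : ∀ q : ZMod 4 × ZMod 4, q = ((0 : ZMod 4), (2 : ZMod 4)) ∨
    ecostZ 0 1 (0, 2) < ecostZ 0 1 q := by decide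

/-- Cell `(1, 2)` is the strict minimiser at `τ = 1/15` (exact integer check, denominators cleared). -/
theorem pieceZ_12 : ∀ q : ZMod 4 × ZMod 4, q = ((1 : ZMod 4), (2 : ZMod 4)) ∨
    ecostZ 1 15 (1, 2) < ecostZ 1 15 q := by decide

/-- Cell `(1, 1)` is the strict minimiser at `τ = 1/11` (exact integer check, denominators cleared). -/
theorem pieceZ_11 : ∀ q : ZMod 4 × ZMod 4, q = ((1 : ZMod 4), (1 : ZMod 4)) ∨
    ecostZ 1 11 (1, 1) < ecostZ 1 11 q := by decide

/-- Cell `(2, 2)` is the strict minimiser at `τ = 1/9` (exact integer check, denominators cleared). -/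
theorem pieceZ_22 : ∀ q : ZMod 4 × ZMod 4, q = ((2 : ZMod 4), (2 : ZMod 4)) ∨
    ecostZ 1 9 (2, 2) < ecostZ 1 9 q := by decide

/-- Cell `(2, 1)` is the strict minimiser at `τ = 1/2` (exact integer check, denominators cleared). -/
theorem pieceZ_21 : ∀ q : ZMod 4 × ZMod 4, q = ((2 : ZMod 4), (1 : ZMod 4)) ∨
    ecostZ 1 2 (2, 1) < ecostZ 1 2 q := by decide

/-- Cell `(3, 1)` is the strict minimiser at `τ = 13/14` (exact integer check, denominators cleared). -/
theorem pieceZ_31 : ∀ q : ZMod 4 × ZMod 4, q = ((3 : ZMod 4), (1 : ZMod 4)) ∨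
    ecostZ 13 14 (3, 1) < ecostZ 13 14 q := by decide

/-- Cell `(2, 0)` is the strict minimiser at `τ = 14/15` (exact integer check, denominators cleared). -/
theorem pieceZ_20 : ∀ q : ZMod 4 × ZMod 4, q = ((2 : ZMod 4), (0 : ZMod 4)) ∨
    ecostZ 14 15 (2, 0) < ecostZ 14 15 q := by decide

/-- Cell `(3, 0)` is the strict minimiser at `τ = 63/64` (exact integer check, denominators cleared). -/
theorem pieceZ_30 : ∀ q : ZMod 4 × ZMod 4, q = ((3 : ZMod 4), (0 : ZMod 4)) ∨
    ecostZ 63 64 (3, 0) < ecostZ 63 64 q := by decide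

/-- Cell `(3, 3)` is the strict minimiser at `τ = 1/1` (exact integer check, denominators cleared). -/
theorem pieceZ_33 : ∀ q : ZMod 4 × ZMod 4, q = ((3 : ZMod 4), (3 : ZMod 4)) ∨
    ecostZ 1 1 (3, 3) < ecostZ 1 1 q := by decide

/-- The nine piece cells. -/
def cells₉ : Finset (ZMod 4 × ZMod 4) := {((0 : ZMod 4), (2 : ZMod 4)), ((1 : ZMod 4), (2 : ZMod 4)), ((1 : ZMod 4), (1 : ZMod 4)), ((2 : ZMod 4), (2 : ZMod 4)), ((2 : ZMod 4), (1 : ZMod 4)), ((3 : ZMod 4), (1 : ZMod 4)), ((2 : ZMod 4), (0 : ZMod 4)), ((3 : ZMod 4), (0 : ZMod 4)), ((3 : ZMod 4), (3 : ZMod 4))}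

/-- They are nine. -/
theorem card_cells₉ : cells₉.card = 9 := by decide

/-- The first coordinates of the nine (ENV) points are pairwise distinct (exact integer check). -/
theorem injZ : ∀ a ∈ cells₉, ∀ b ∈ cells₉, psiZ a.2 + cZ (a.1 + a.2) = psiZ b.2 + cZ (b.1 + b.2) → a = b := by
  decide

/-- Hence `envPt` is injective on `cells₉`. -/
theorem envPt_injOn : Set.InjOn (envPt φ₄ ψ₄ c₄) (cells₉ : Set (ZMod 4 × ZMod 4)) := by
  intro a ha b hb hab
  have h0 := congrFun hab 0
  simp only [envPt, cons_val_zero, φ₄, ψ₄, c₄] at h0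
  exact injZ a (Finset.mem_coe.1 ha) b (Finset.mem_coe.1 hb) (by exact_mod_cast h0)

/-- Every cell's point lies in `envPts`. [folklore] -/
theorem envPt_mem (cl : ZMod 4 × ZMod 4) : envPt φ₄ ψ₄ c₄ cl ∈ envPts φ₄ ψ₄ c₄ := by
  classical
  unfold envPts
  exact Finset.mem_image.2 ⟨cl, Finset.mem_univ _, rfl⟩

/-- **`9 ≤ envPieces φ₄ ψ₄ c₄`.** -/
theorem nine_le_envPieces : 9 ≤ envPieces φ₄ ψ₄ c₄ := by
  classical
  unfold envPieces swCount
  rw [← card_cells₉]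
  refine Finset.card_le_card_of_injOn (envPt φ₄ ψ₄ c₄) (fun cl hcl => ?_) envPt_injOn
  simp only [Finset.coe_filter, Set.mem_setOf_eq]
  simp only [Finset.mem_coe, cells₉, Finset.mem_insert, Finset.mem_singleton] at hcl
  rcases hcl with rfl | rfl | rfl | rfl | rfl | rfl | rfl | rfl | rfl
  · exact ⟨envPt_mem _, isSWExposed_of_ecostZ 0 1 (by norm_num) (by norm_num) (by norm_num) _ pieceZ_02⟩
  · exact ⟨envPt_mem _, isSWExposed_of_ecostZ 1 15 (by norm_num) (by norm_num) (by norm_num) _ pieceZ_12⟩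
  · exact ⟨envPt_mem _, isSWExposed_of_ecostZ 1 11 (by norm_num) (by norm_num) (by norm_num) _ pieceZ_11⟩
  · exact ⟨envPt_mem _, isSWExposed_of_ecostZ 1 9 (by norm_num) (by norm_num) (by norm_num) _ pieceZ_22⟩
  · exact ⟨envPt_mem _, isSWExposed_of_ecostZ 1 2 (by norm_num) (by norm_num) (by norm_num) _ pieceZ_21⟩
  · exact ⟨envPt_mem _, isSWExposed_of_ecostZ 13 14 (by norm_num) (by norm_num) (by norm_num) _ pieceZ_31⟩
  · exact ⟨envPt_mem _, isSWExposed_of_ecostZ 14 15 (by norm_num) (by norm_num) (by norm_num) _ pieceZ_20⟩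
  · exact ⟨envPt_mem _, isSWExposed_of_ecostZ 63 64 (by norm_num) (by norm_num) (by norm_num) _ pieceZ_30⟩
  · exact ⟨envPt_mem _, isSWExposed_of_ecostZ 1 1 (by norm_num) (by norm_num) (by norm_num) _ pieceZ_33⟩

/-- **`¬ EnvelopeBound 2`**: the located constant of the envelope bound is at least `3`. -/
theorem not_envelopeBound_two : ¬ EnvelopeBound 2 := by
  intro h
  have h1 := h (ZMod 4) φ₄ ψ₄ c₄
  have h2 := nine_le_envPieces
  simp only [ZMod.card] at h1
  omega

/-- `EnvelopeBound C → 3 ≤ C`. -/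
theorem envelopeBound_three_le {C : ℕ} (h : EnvelopeBound C) : 3 ≤ C := by
  by_contra hC
  have h1 := h (ZMod 4) φ₄ ψ₄ c₄
  have h2 := nine_le_envPieces
  simp only [ZMod.card] at h1
  have : C * 4 ≤ 8 := by nlinarith
  omega

end EnvCex4

end TotalsLaw

end Summit.ValiantsHypothesis.ValiantsHypothesis.Theorems.NewtonUnitEquationsDissociatedUniform
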